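import Mathlib
import HarnessLib
import Summits.HubbardSuperconductivity.HubbardSuperconductivity.Theorems.BalabanIRBirGappedPhaseReductionRSlavedTrotterEqualTimeAlgebra
import Summits.HubbardSuperconductivity.HubbardSuperconductivity.Theorems.BalabanIRBirGappedPhaseReductionRSlavedTrotterInsertion

/-!
# BalabanIR reduction `BirGappedPhaseReductionR` (stmt-14846): slaved block pair field — the EQUAL-TIME SLAVING IDENTITY in the Trotter limit

Support file (`--supports stmt-HubbardSuperconductivity-14846`; prover seat 2, session 11), seventh
part of the slaved pair-field dictionary (card `slaved-pair-field-os-dictionary`).  THE RESULT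
(`tendsto_equalTime_fieldTwoPoint_trace`): for any `H`, any block family `B : Fin m → Mat_n(ℂ)`,
`κ, β > 0` and blocks `b₁ < b₂`, the EQUAL-TIME (time-zero slice) field two-point function of the
fully slaved many-block representation converges, in the Trotter limit `M → ∞`
(`a = β/(M+1)`, `φ_k = r iᵏ`, `r² = (M+1)/(κβ)`), to the equal-time pair correlation:

  `(1/4)^{m(M+1)} Σ_P conj φ_{P0b₁} φ_{P0b₂} · tr Π_τ [e^{-aH'} Π_b e^{aκ(conj φ_{Pτb} B_b + φ_{Pτb} B_bᴴ)}]
     ⟶ tr (B_{b₁}ᴴ B_{b₂} e^{-βH})`,   `H' = H + (κ/2)Σ_b (B_bB_bᴴ + B_bᴴB_b)`.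

"Field LRO = equal-time pair LRO" is thus an IDENTITY of the representation (no cross term, no
Josephson rotation: TRIAGE-r1-3 T5), in the direction the target `X_avg` needs.  Ingredients: the
exact finite-`M` identity `sum_insertion_slavedWeightBlocks_eq` (`…EqualTimeAlgebra`), the one-slice
slaving identities (`…Insertion`), `‖S̄_b - 1‖ = O(a^{1/2})` (`norm_avgSlice_sub_one_le`, here), the
`m`-block per-slice estimate (`…Blocks`) and Chernoff's product formula for the `M`-th power of
the `(M+1)`-st approximant (`tendsto_pow_of_norm_sub_exp_le`, Literature).
-/

noncomputable section

namespace Summit.HubbardSuperconductivity.HubbardSuperconductivity.Theorems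

open scoped Matrix.Norms.L2Operator ComplexConjugate
open Matrix Filter Topology NormedSpace
open Literature.MathematicalPhysics.QuantumLattice

variable {n : Type*} [Fintype n] [DecidableEq n]

/-! ### The averaged slice tends to `1` -/

/-- `‖¼Σ_k e^{aκ(conj φ_k B + φ_k Bᴴ)} - 1‖ ≤ (aκr) · (‖B‖+‖Bᴴ‖) e^{(1+κ)(‖B‖+‖Bᴴ‖)}` for `0 ≤ a ≤ 1`,
`r ≥ 0`, `aκr² = 1` (first-order Taylor remainder; `aκr = (aκ)^{1/2}`). [folklore] -/
theorem norm_avgSlice_sub_one_le [Nonempty n] (B : Matrix n n ℂ) {κ : ℝ} (hκ : 0 ≤ κ) {a r : ℝ}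
    (ha0 : 0 ≤ a) (ha1 : a ≤ 1) (hr : 0 ≤ r) (hakr : a * κ * r ^ 2 = 1) :
    ‖(1 / 4 : ℂ) • ∑ k : Fin 4, gibbsWeight (-(a * κ))
        (conj ((r : ℂ) * Complex.I ^ (k : ℕ)) • B + ((r : ℂ) * Complex.I ^ (k : ℕ)) • Bᴴ) - 1‖ ≤
      (a * κ * r) * ((‖B‖ + ‖Bᴴ‖) * Real.exp ((1 + κ) * (‖B‖ + ‖Bᴴ‖))) := by
  obtain ⟨b, hb⟩ : ∃ b : ℝ, ‖B‖ + ‖Bᴴ‖ = b := ⟨_, rfl⟩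
  have hb0 : 0 ≤ b := hb ▸ add_nonneg (norm_nonneg _) (norm_nonneg _)
  obtain ⟨s, hs⟩ : ∃ s : ℝ, a * κ * r = s := ⟨_, rfl⟩
  have hs0 : 0 ≤ s := by rw [← hs]; positivity
  have hs2 : s ^ 2 = a * κ := by
    have e : s ^ 2 = (a * κ) * (a * κ * r ^ 2) := by rw [← hs]; ring
    rw [e, hakr, mul_one]
  have hs1 : s ≤ 1 + κ := by
    have h1 : s ^ 2 ≤ (1 + κ) ^ 2 := by
      rw [hs2]; nlinarith [mul_le_of_le_one_left hκ ha1, sq_nonneg κ]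
    calc s = Real.sqrt (s ^ 2) := (Real.sqrt_sq hs0).symm
      _ ≤ Real.sqrt ((1 + κ) ^ 2) := Real.sqrt_le_sqrt h1
      _ = 1 + κ := Real.sqrt_sq (by positivity)
  rw [hb]
  simp only [gibbsWeight, Complex.ofReal_neg, neg_neg]
  have hz : ∀ k : Fin 4, ‖((a * κ : ℝ) : ℂ) •
      (conj ((r : ℂ) * Complex.I ^ (k : ℕ)) • B + ((r : ℂ) * Complex.I ^ (k : ℕ)) • Bᴴ)‖ ≤ s * b := by
    intro k
    rw [norm_smul, Complex.norm_real, Real.norm_of_nonneg (by positivity : 0 ≤ a * κ)]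
    have hW : ‖conj ((r : ℂ) * Complex.I ^ (k : ℕ)) • B + ((r : ℂ) * Complex.I ^ (k : ℕ)) • Bᴴ‖
        ≤ r * b :=
      calc _ ≤ ‖conj ((r : ℂ) * Complex.I ^ (k : ℕ)) • B‖ + ‖((r : ℂ) * Complex.I ^ (k : ℕ)) • Bᴴ‖ :=
            norm_add_le _ _
        _ = r * b := by
            rw [norm_smul, norm_smul, Complex.norm_conj, norm_nu4, abs_of_nonneg hr, ← hb]; ring
    calc a * κ * _ ≤ a * κ * (r * b) := by gcongr
      _ = s * b := by rw [← hs]; ring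
  have hsb : s * b ≤ (1 + κ) * b := mul_le_mul_of_nonneg_right hs1 hb0
  -- `S̄ - 1 = ¼ Σ_k (exp Z_k - 1)`
  have e : (1 / 4 : ℂ) • ∑ k : Fin 4, exp (((a * κ : ℝ) : ℂ) •
      (conj ((r : ℂ) * Complex.I ^ (k : ℕ)) • B + ((r : ℂ) * Complex.I ^ (k : ℕ)) • Bᴴ)) - 1 =
      (1 / 4 : ℂ) • ∑ k : Fin 4, (exp (((a * κ : ℝ) : ℂ) •
        (conj ((r : ℂ) * Complex.I ^ (k : ℕ)) • B + ((r : ℂ) * Complex.I ^ (k : ℕ)) • Bᴴ)) - 1) := by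
    rw [Finset.sum_sub_distrib, Finset.sum_const, Finset.card_univ, Fintype.card_fin, smul_sub,
      ← Nat.cast_smul_eq_nsmul ℂ, smul_smul]
    norm_num
  rw [e]
  have hT : ∀ k : Fin 4, ‖exp (((a * κ : ℝ) : ℂ) •
      (conj ((r : ℂ) * Complex.I ^ (k : ℕ)) • B + ((r : ℂ) * Complex.I ^ (k : ℕ)) • Bᴴ)) - 1‖ ≤
        s * (b * Real.exp ((1 + κ) * b)) := by
    intro k
    have h1 := norm_exp_sub_taylor_le ℂ (((a * κ : ℝ) : ℂ) •
      (conj ((r : ℂ) * Complex.I ^ (k : ℕ)) • B + ((r : ℂ) * Complex.I ^ (k : ℕ)) • Bᴴ)) 1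
    simp only [Finset.sum_range_one, Nat.factorial_zero, Nat.cast_one, inv_one, one_smul, pow_zero,
      pow_one] at h1
    calc _ ≤ _ := h1
      _ ≤ (s * b) * Real.exp ((1 + κ) * b) := by
          gcongr
          · exact hz k
          · exact (hz k).trans hsb
      _ = s * (b * Real.exp ((1 + κ) * b)) := by ring
  calc ‖(1 / 4 : ℂ) • ∑ k : Fin 4, (exp (((a * κ : ℝ) : ℂ) •
        (conj ((r : ℂ) * Complex.I ^ (k : ℕ)) • B + ((r : ℂ) * Complex.I ^ (k : ℕ)) • Bᴴ)) - 1)‖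
      ≤ ‖(1 / 4 : ℂ)‖ * ∑ k : Fin 4, ‖exp (((a * κ : ℝ) : ℂ) •
        (conj ((r : ℂ) * Complex.I ^ (k : ℕ)) • B + ((r : ℂ) * Complex.I ^ (k : ℕ)) • Bᴴ)) - 1‖ := by
        rw [norm_smul]; gcongr; exact norm_sum_le _ _
    _ ≤ ‖(1 / 4 : ℂ)‖ * ∑ _k : Fin 4, s * (b * Real.exp ((1 + κ) * b)) := by gcongr with k; exact hT k
    _ = s * (b * Real.exp ((1 + κ) * b)) := by
        have h4 : ‖(1 / 4 : ℂ)‖ = 1 / 4 := by simp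
        rw [Finset.sum_const, Finset.card_univ, Fintype.card_fin, nsmul_eq_mul, h4]
        push_cast
        ring
    _ = (a * κ * r) * (b * Real.exp ((1 + κ) * b)) := by rw [hs]

/-! ### The equal-time slaving identity in the Trotter limit -/

/-- **Equal-time slaving identity (Trotter limit, trace form).** For any `H`, any block family
`B : Fin m → Mat_n(ℂ)`, `κ, β > 0` and blocks `b₁ < b₂`: with `a = β/(M+1)`, `φ_k = r iᵏ`,
`r = ((M+1)/(κβ))^{1/2}`, `H' = H + (κ/2)Σ_b(B_bB_bᴴ + B_bᴴB_b)` and single-block slices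
`S_b(k) = e^{aκ(conj φ_k B_b + φ_k B_bᴴ)}`,
`(1/4)^{m(M+1)} Σ_{P : Fin (M+1) → Fin m → Fin 4} conj φ_{P0b₁} φ_{P0b₂} tr Π_τ [e^{-aH'} Π_b S_b(Pτb)]
 → tr (B_{b₁}ᴴ B_{b₂} e^{-βH})` as `M → ∞` — the equal-time two-point function of the slaved
block field IS the equal-time pair correlation `⟨B_{b₁}ᴴ B_{b₂}⟩_β · Z`. [folklore] -/
theorem tendsto_equalTime_fieldTwoPoint_trace (H : Matrix n n ℂ) {m : ℕ} (B : Fin m → Matrix n n ℂ)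
    {κ β : ℝ} (hκ : 0 < κ) (hβ : 0 < β) (b₁ b₂ : Fin m) (hb : b₁ < b₂) :
    Tendsto (fun M : ℕ =>
      (1 / 4 : ℂ) ^ (m * (M + 1)) * ∑ P : Fin (M + 1) → Fin m → Fin 4,
        (conj ((Real.sqrt (((M : ℝ) + 1) / (κ * β)) : ℂ) * Complex.I ^ ((P 0 b₁ : Fin 4) : ℕ)) *
            ((Real.sqrt (((M : ℝ) + 1) / (κ * β)) : ℂ) * Complex.I ^ ((P 0 b₂ : Fin 4) : ℕ))) *
          ((List.ofFn fun τ : Fin (M + 1) =>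
            gibbsWeight (β / ((M : ℝ) + 1)) (H + ((κ / 2 : ℝ) : ℂ) • ∑ b, (B b * (B b)ᴴ + (B b)ᴴ * B b)) *
              (List.ofFn fun b => gibbsWeight (-(β / ((M : ℝ) + 1) * κ))
                (conj ((Real.sqrt (((M : ℝ) + 1) / (κ * β)) : ℂ) * Complex.I ^ ((P τ b : Fin 4) : ℕ)) • B b +
                  ((Real.sqrt (((M : ℝ) + 1) / (κ * β)) : ℂ) * Complex.I ^ ((P τ b : Fin 4) : ℕ)) •
                    (B b)ᴴ)).prod).prod).trace)
      atTop (𝓝 (((B b₁)ᴴ * B b₂ * gibbsWeight β H).trace)) := by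
  rcases isEmpty_or_nonempty n with hn | hn
  · have h0 : ∀ X : Matrix n n ℂ, X.trace = 0 := fun X => by
      simp [Matrix.trace]
    simp only [h0, mul_zero, Finset.sum_const_zero]
    exact tendsto_const_nhds
  -- abstract the two parameter sequences
  obtain ⟨a, ha⟩ : ∃ a : ℕ → ℝ, ∀ M : ℕ, β / ((M : ℝ) + 1) = a M :=
    ⟨fun M => β / ((M : ℝ) + 1), fun _ => rfl⟩
  obtain ⟨r, hr⟩ : ∃ r : ℕ → ℝ, ∀ M : ℕ, Real.sqrt (((M : ℝ) + 1) / (κ * β)) = r M :=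
    ⟨fun M => Real.sqrt (((M : ℝ) + 1) / (κ * β)), fun _ => rfl⟩
  simp only [ha, hr]
  have hM : ∀ M : ℕ, (0 : ℝ) < (M : ℝ) + 1 := fun M => by positivity
  have ha0 : ∀ M, 0 < a M := fun M => by rw [← ha]; exact div_pos hβ (hM M)
  have hr0 : ∀ M, 0 ≤ r M := fun M => by rw [← hr]; exact Real.sqrt_nonneg _
  have hakr : ∀ M, a M * κ * r M ^ 2 = 1 := fun M => by
    rw [← hr, ← ha, Real.sq_sqrt (by positivity)]
    field_simp
  have ha_t : Tendsto a atTop (𝓝 0) := by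
    have e : a = fun M : ℕ => β * (1 / ((M : ℝ) + 1)) := funext fun M => by rw [← ha]; ring
    rw [e]
    simpa using (tendsto_one_div_add_atTop_nhds_zero_nat).const_mul β
  have ha1 : ∀ᶠ M : ℕ in atTop, a M ≤ 1 := ha_t.eventually (ge_mem_nhds one_pos)
  have hs_t : Tendsto (fun M => a M * κ * r M) atTop (𝓝 0) := by
    have hs : ∀ M, a M * κ * r M = Real.sqrt (κ * a M) := fun M => by
      have h2 : (a M * κ * r M) ^ 2 = κ * a M := by
        have e : (a M * κ * r M) ^ 2 = (a M * κ) * (a M * κ * r M ^ 2) := by ring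
        rw [e, hakr M, mul_one, mul_comm]
      rw [← h2, Real.sqrt_sq (by have := (ha0 M).le; have := hr0 M; positivity)]
    simp only [hs]
    simpa using (ha_t.const_mul κ).sqrt
  -- the players
  set H' : Matrix n n ℂ := H + ((κ / 2 : ℝ) : ℂ) • ∑ b, (B b * (B b)ᴴ + (B b)ᴴ * B b) with hH'
  set G : ℕ → Matrix n n ℂ := fun M => gibbsWeight (a M) H' with hG
  set S : ℕ → Fin m → Fin 4 → Matrix n n ℂ := fun M b k => gibbsWeight (-(a M * κ))
    (conj (((r M : ℝ) : ℂ) * Complex.I ^ (k : ℕ)) • B b + (((r M : ℝ) : ℂ) * Complex.I ^ (k : ℕ)) • (B b)ᴴ)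
    with hS
  set E : ℕ → Fin m → Matrix n n ℂ := fun M b => ∑ k : Fin 4, ((1 / 4 : ℂ) *
    (if b = b₁ then conj (((r M : ℝ) : ℂ) * Complex.I ^ (k : ℕ)) else
      if b = b₂ then ((r M : ℝ) : ℂ) * Complex.I ^ (k : ℕ) else 1)) • S M b k with hE
  set F : ℕ → Matrix n n ℂ := fun M => G M * (List.ofFn fun b => (1 / 4 : ℂ) • ∑ k, S M b k).prod with hF
  set Einf : Fin m → Matrix n n ℂ := fun b => if b = b₁ then (B b₁)ᴴ else if b = b₂ then B b₂ else 1
    with hEinf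
  -- the exact finite-`M` identity, in trace form
  have hid : ∀ M : ℕ, (1 / 4 : ℂ) ^ (m * (M + 1)) * ∑ P : Fin (M + 1) → Fin m → Fin 4,
      (conj (((r M : ℝ) : ℂ) * Complex.I ^ ((P 0 b₁ : Fin 4) : ℕ)) *
          (((r M : ℝ) : ℂ) * Complex.I ^ ((P 0 b₂ : Fin 4) : ℕ))) *
        ((List.ofFn fun τ : Fin (M + 1) => G M * (List.ofFn fun b => S M b (P τ b)).prod).prod).trace =
      ((G M * (List.ofFn (E M)).prod) * (F M) ^ M).trace := by
    intro M
    have h := sum_insertion_slavedWeightBlocks_eq (M := M) (G M) (S M)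
      (fun k => conj (((r M : ℝ) : ℂ) * Complex.I ^ (k : ℕ))) (fun k => ((r M : ℝ) : ℂ) * Complex.I ^ (k : ℕ))
      b₁ b₂ hb.ne
    rw [← h, Matrix.trace_smul, Matrix.trace_sum, smul_eq_mul]
    congr 1
    refine Finset.sum_congr rfl fun P _ => ?_
    rw [Matrix.trace_smul, smul_eq_mul]
  -- (a) `G_M → 1`
  have hG_t : Tendsto G atTop (𝓝 1) := by
    letI : NormedAlgebra ℚ (Matrix n n ℂ) := NormedAlgebra.restrictScalars ℚ ℂ (Matrix n n ℂ)
    have h1 : Tendsto (fun M => -((a M : ℝ) : ℂ) • H') atTop (𝓝 ((-((0 : ℝ) : ℂ)) • H')) :=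
      ((Complex.continuous_ofReal.tendsto 0).comp ha_t).neg.smul_const H'
    have h2 := (exp_continuous.tendsto _).comp h1
    simp only [Complex.ofReal_zero, neg_zero, zero_smul, exp_zero] at h2
    exact h2
  -- (b) the insertion slices converge
  have hE_t : ∀ b, Tendsto (fun M => E M b) atTop (𝓝 (Einf b)) := by
    intro b
    by_cases h1 : b = b₁
    · subst h1
      obtain ⟨C, _, hC⟩ := exists_norm_conjField_insertion_sub_le (B b) hκ.le
      have he : ∀ M, E M b = (1 / 4 : ℂ) • ∑ k : Fin 4, conj (((r M : ℝ) : ℂ) * Complex.I ^ (k : ℕ)) •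
          S M b k := fun M => by
        simp only [hE, ↓reduceIte, ← smul_smul, ← Finset.smul_sum]
      simp only [he, hEinf, ↓reduceIte]
      rw [tendsto_iff_norm_sub_tendsto_zero]
      refine squeeze_zero_norm' ?_ (by simpa using ha_t.const_mul C)
      filter_upwards [ha1] with M hM1
      rw [Real.norm_of_nonneg (norm_nonneg _)]
      exact hC (a M) (r M) (ha0 M).le hM1 (hr0 M) (hakr M)
    · by_cases h2 : b = b₂
      · subst h2
        obtain ⟨C, _, hC⟩ := exists_norm_field_insertion_sub_le (B b) hκ.le
        have he : ∀ M, E M b = (1 / 4 : ℂ) • ∑ k : Fin 4, (((r M : ℝ) : ℂ) * Complex.I ^ (k : ℕ)) •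
            S M b k := fun M => by
          simp only [hE, if_neg h1, ↓reduceIte, ← smul_smul, ← Finset.smul_sum]
        simp only [he, hEinf, if_neg h1, ↓reduceIte]
        rw [tendsto_iff_norm_sub_tendsto_zero]
        refine squeeze_zero_norm' ?_ (by simpa using ha_t.const_mul C)
        filter_upwards [ha1] with M hM1
        rw [Real.norm_of_nonneg (norm_nonneg _)]
        exact hC (a M) (r M) (ha0 M).le hM1 (hr0 M) (hakr M)
      · have he : ∀ M, E M b = (1 / 4 : ℂ) • ∑ k : Fin 4, S M b k := fun M => by
          simp only [hE, if_neg h1, if_neg h2, mul_one, ← Finset.smul_sum]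
        simp only [he, hEinf, if_neg h1, if_neg h2]
        rw [tendsto_iff_norm_sub_tendsto_zero]
        refine squeeze_zero_norm' ?_
          (by simpa using hs_t.mul_const ((‖B b‖ + ‖(B b)ᴴ‖) * Real.exp ((1 + κ) * (‖B b‖ + ‖(B b)ᴴ‖))))
        filter_upwards [ha1] with M hM1
        rw [Real.norm_of_nonneg (norm_nonneg _)]
        exact norm_avgSlice_sub_one_le (B b) hκ.le (ha0 M).le hM1 (hr0 M) (hakr M)
  -- (c) hence the ordered product of the insertion slices converges
  have hPE_t : Tendsto (fun M => (List.ofFn (E M)).prod) atTop (𝓝 ((B b₁)ᴴ * B b₂)) := by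
    have h1 : Tendsto (fun M => ((List.finRange m).map fun b => E M b).prod) atTop
        (𝓝 (((List.finRange m).map Einf).prod)) :=
      tendsto_list_prod _ fun b _ => hE_t b
    have h2 : (List.ofFn Einf).prod = (B b₁)ᴴ * B b₂ := by
      rw [hEinf]
      exact prod_ofFn_ite_ite_one b₁ b₂ hb _ _
    simp only [← List.ofFn_eq_map] at h1
    rw [h2] at h1
    exact h1
  -- (d) the free slices: `F_M^M → e^{-βH}`
  have hF_t : Tendsto (fun M => (F M) ^ M) atTop (𝓝 (gibbsWeight β H)) := by
    obtain ⟨C, hC⟩ := exists_norm_slavedSliceBlocks_sub_gibbsWeight_le H hκ.le B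
    have hexact : ∀ M : ℕ, exp ((((M + 1 : ℕ) : ℂ))⁻¹ • (-(β : ℂ) • H)) = gibbsWeight (a M) H := by
      intro M
      rw [gibbsWeight, smul_smul, ← ha]
      congr 1
      push_cast
      field_simp
    have key := tendsto_pow_of_norm_sub_exp_le (𝕂 := ℂ) (-(β : ℂ) • H) F
      (fun M => C * (a M * (a M * κ * r M + a M))) ?_ ?_
    · rw [show gibbsWeight β H = exp (-(β : ℂ) • H) from rfl]
      exact key
    · filter_upwards [ha1] with M hM1
      rw [hexact M]
      exact hC (a M) (r M) (ha0 M).le hM1 (hr0 M) (hakr M)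
    · have hsum_t : Tendsto (fun M => C * β * (a M * κ * r M + a M)) atTop (𝓝 0) := by
        simpa using (hs_t.add ha_t).const_mul (C * β)
      refine hsum_t.congr fun M => ?_
      have e : ((M : ℝ) + 1) * a M = β := by rw [← ha]; field_simp
      calc C * β * (a M * κ * r M + a M) = C * (((M : ℝ) + 1) * a M) * (a M * κ * r M + a M) := by
            rw [e]
        _ = ((M : ℝ) + 1) * (C * (a M * (a M * κ * r M + a M))) := by ring
  -- (e) assemble
  have hall : Tendsto (fun M => G M * (List.ofFn (E M)).prod * F M ^ M) atTop
      (𝓝 ((B b₁)ᴴ * B b₂ * gibbsWeight β H)) := by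
    have h := (hG_t.mul hPE_t).mul hF_t
    simpa only [one_mul] using h
  have htr : Tendsto (fun M => (G M * (List.ofFn (E M)).prod * F M ^ M).trace) atTop
      (𝓝 (((B b₁)ᴴ * B b₂ * gibbsWeight β H).trace)) :=
    ((continuous_id.matrix_trace).tendsto _).comp hall
  exact htr.congr fun M => (hid M).symm

/-- **Registered form** (`stub_add`ed on stmt-14846 as `slavedEqualTimeIdentity`): the equal-time
slaving identity in the Trotter limit, `tendsto_equalTime_fieldTwoPoint_trace` with all parameters
universally quantified. [folklore] -/
theorem slavedEqualTimeIdentity : ∀ (n : Type) [Fintype n] [DecidableEq n] (H : Matrix n n ℂ) (m : ℕ) (B : Fin m → Matrix n n ℂ) (κ β : ℝ), 0 < κ → 0 < β → ∀ (b₁ b₂ : Fin m), b₁ < b₂ → Filter.Tendsto (fun M : ℕ => (1 / 4 : ℂ) ^ (m * (M + 1)) * ∑ P : Fin (M + 1) → Fin m → Fin 4, ((starRingEnd ℂ) ((Real.sqrt (((M : ℝ) + 1) / (κ * β)) : ℂ) * Complex.I ^ ((P 0 b₁ : Fin 4) : ℕ)) * ((Real.sqrt (((M : ℝ) + 1) /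 (κ * β)) : ℂ) * Complex.I ^ ((P 0 b₂ : Fin 4) : ℕ))) * ((List.ofFn fun τ : Fin (M + 1) => Matrix.gibbsWeight (β / ((M : ℝ) + 1)) (H + ((κ / 2 : ℝ) : ℂ) • ∑ b, (B b * Matrix.conjTranspose (B b) + Matrix.conjTranspose (B b) * B b)) * (List.ofFn fun b => Matrix.gibbsWeight (-(β / ((M : ℝ) + 1) * κ)) ((starRingEnd ℂ) ((Real.sqrt (((M : ℝ) + 1) / (κ * β)) : ℂ) * Complex.I ^ ((P τ b : Fin 4) : ℕ)) • B b + ((Real.sqrt (((M : ℝ) + 1) / (κ * β)) : ℂ) * Complex.I ^ ((P τ b : Fin 4) : ℕ)) • Matrix.conjTranspose (B b))).prod).prod).trace) Filter.atTop (nhds ((Matrix.conjTranspose (B b₁) * B b₂ * Matrix.gibbsWeight β H).trace)) :=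
  fun _ _ _ H _ B _ _ hκ hβ b₁ b₂ hb => tendsto_equalTime_fieldTwoPoint_trace H B hκ hβ b₁ b₂ hb

end Summit.HubbardSuperconductivity.HubbardSuperconductivity.Theorems

end
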